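import Literature.AlgebraicGeometry.GroupSchemes.UnitComponentOfFiniteGroupScheme
import Literature.AlgebraicGeometry.GroupSchemes.ConnectedFactorsThroughUnitComponent
import Literature.AlgebraicGeometry.GroupSchemes.BarsottiTateGroupTorsionLayers
import Literature.AlgebraicGeometry.Motives.GoodReductionFormalFunctionsProofs
import HarnessLib

/-!
# The UNIT-COMPONENT SUB-TOWER `B[pⁿ]⁰ ↪ B[pⁿ]` of a Barsotti–Tate group over an Artinian local base
# ([Tate1967] (2.4) «the connected part `G⁰`»; [Tate1997FiniteFlatGroupSchemes] (3.7) (I))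

Topic `Literature/AlgebraicGeometry/GroupSchemes`; namespace `Literature.AlgebraicGeometry.GroupSchemes.BTGroup`.  THEOREMS ONLY (no definition, no
named fact, no instance, no notation, no `sorry`).

THE PRINT.  [Tate1997FiniteFlatGroupSchemes] (3.7) (I): over a henselian local base every finite group scheme `G` has a UNIT COMPONENT `G⁰ ↪ G`, an open
and closed (finite, flat when `G` is) connected subgroup scheme through the unit; [Tate1967] (2.4): for a `p`-divisible group `G = (G_ν)` the unit
components `G_ν⁰` form a sub-system («the connected part»), the transition `G_ν → G_{ν+1}` carrying `G_ν⁰` into `G_{ν+1}⁰` (a connected scheme through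
the unit lands in the unit component).  An ARTINIAN local ring is henselian (it is `𝔪`-adically complete, `𝔪` being nilpotent).

THIS FILE packages, for `B : BTGroup (Spec A) p h` over an Artinian local `A` (★ `BTGroup`, Tate's form), the SCHEME-side data of that sub-system in the
exact currency of its two consumers in the tree — the translation cover ★ `BTGroup.exists_finiteFlat_cover_lift` (`G₀ n`, `j n` open + closed
immersions, `hunit : range η ⊆ range (j n)`) and the unit-component lifting ★ `subtower_liftsAlong_of_iInf_ker_eq_bot_of_isAffine` (`[IsAffine (G₀ n).left]`,
`ι : G₀ n → G₀ m` with `ι ≫ j m = j n ≫ transition`):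
* `henselianLocalRing_of_isArtinianRing` — an Artinian local ring is henselian (Mathlib `IsAdicComplete.henselianRing` on ★ `isAdicComplete_of_isNilpotent`);
* **`exists_unitComponentTower`** — `∃ G₀ (GrpObj) j ι`: `j n` homomorphic OPEN AND CLOSED immersions with CONNECTED, AFFINE, finite flat sources
  (★ `UnitComponentOfFiniteGroupScheme.exists_unitComponent`, ★ `isFinite_and_flat_of_immersions`), the unit sections factor through them, and the
  sub-tower maps `ι h : G₀ n → G₀ m` (`n ≤ m`) — the unique factorisations of `j n ≫ transition` through `j m` (★ `ConnectedFactorsThroughUnitComponent`)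
  — are CLOSED IMMERSIONS, with `ι (le_refl) = 𝟙` and `ι h₁ ≫ ι h₂ = ι (h₁.trans h₂)`.
NOT here (the ALGEBRA side, sibling organ): `Γ(G₀ n)` finite free over `A`, `Γ(ι)` surjective, the special fibres `Γ(G₀ n) ⧸ 𝔪` and their power-series
presentation ([Tate1967] §2.2).  Written for cell `hodgecm-mathlib` (P6b σ2 E2a, (s2) road, spine S1); HC_CM is proved only modulo the 7 printed citations
until rung 0 closes; nothing here is about HC.

## References
* [Tate1967] J. T. Tate, *p-divisible groups*, Proc. Conf. Local Fields (Driebergen 1966), Springer (1967), (2.4), §2.2.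
* [Tate1997FiniteFlatGroupSchemes] J. Tate, *Finite flat group schemes*, in: Modular Forms and Fermat's Last Theorem (1997), (3.7) (I).
-/

noncomputable section

universe u

open CategoryTheory CategoryTheory.Limits AlgebraicGeometry MonoidalCategory CartesianMonoidalCategory IsLocalRing
open scoped MonObj

namespace Literature.AlgebraicGeometry.GroupSchemes

/-- **An Artinian local ring is henselian**: its maximal ideal is nilpotent, so the ring is `𝔪`-adically complete (★ `isAdicComplete_of_isNilpotent`)
and complete local rings are henselian (Mathlib `IsAdicComplete.henselianRing`). [cite: Tate1997FiniteFlatGroupSchemes, (3.7) (I)] -/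
theorem henselianLocalRing_of_isArtinianRing (A : Type u) [CommRing A] [IsArtinianRing A] [IsLocalRing A] : HenselianLocalRing A := by
  have hnil : IsNilpotent (maximalIdeal A) := by
    have := IsArtinianRing.isNilpotent_jacobson_bot (R := A)
    rwa [IsLocalRing.jacobson_eq_maximalIdeal ⊥ bot_ne_top] at this
  haveI : IsAdicComplete (maximalIdeal A) A := Literature.AlgebraicGeometry.Motives.isAdicComplete_of_isNilpotent _ hnil
  exact { is_henselian := fun f hf a₀ h₁ h₂ => HenselianRing.is_henselian (I := maximalIdeal A) f hf a₀ h₁ (h₂.map _) }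

namespace BTGroup

variable {A : Type u} [CommRing A] [IsArtinianRing A] [IsLocalRing A] {p h : ℕ} (B : BTGroup (Spec (.of A)) p h)

/-- **THE UNIT-COMPONENT SUB-TOWER OF A BARSOTTI–TATE GROUP OVER AN ARTINIAN LOCAL BASE** ([Tate1967] (2.4); [Tate1997FiniteFlatGroupSchemes] (3.7) (I)).
For `B : BTGroup (Spec A) p h`, `A` Artinian local: there are group objects `G₀ n` of `Over (Spec A)`, homomorphisms `j n : G₀ n ⟶ B.G n` and maps
`ι h : (G₀ n).left ⟶ (G₀ m).left` (`n ≤ m`) such that: each `(j n).left` is an OPEN AND CLOSED IMMERSION with CONNECTED, AFFINE source, `G₀ n → Spec A`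
is FINITE and FLAT, the unit section of `B.G n` factors through `j n` (`range η ⊆ range (j n)`), `ι h ≫ (j m).left = (j n).left ≫ (B.transition h).left`,
each `ι h` is a CLOSED IMMERSION over `Spec A` (`ι h ≫ (G₀ m).hom = (G₀ n).hom`), `ι (le_refl n) = 𝟙`, and `ι h₁ ≫ ι h₂ = ι (h₁.trans h₂)` — the data `(G₀, j, ι, hιj)` of ★
`subtower_liftsAlong_of_iInf_ker_eq_bot_of_isAffine` and `(G₀, j, hjo, hjc, hunit)` of ★ `exists_finiteFlat_cover_lift`, token for token.
[cite: Tate1967, (2.4)] [cite: Tate1997FiniteFlatGroupSchemes, (3.7) (I)] -/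
theorem exists_unitComponentTower :
    ∃ (G₀ : ℕ → Over (Spec (.of A))) (_ : ∀ n, GrpObj (G₀ n)) (j : ∀ n, G₀ n ⟶ B.G n)
      (incl₀ : ∀ ⦃n m : ℕ⦄, n ≤ m → ((G₀ n).left ⟶ (G₀ m).left)),
      (∀ n, letI := B.grpObj n; IsMonHom (j n)) ∧ (∀ n, IsOpenImmersion (j n).left) ∧ (∀ n, IsClosedImmersion (j n).left) ∧
      (∀ n, ConnectedSpace ↥(G₀ n).left) ∧ (∀ n, IsAffine (G₀ n).left) ∧ (∀ n, IsFinite (G₀ n).hom) ∧ (∀ n, Flat (G₀ n).hom) ∧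
      (∀ n, letI := B.grpObj n; Set.range (η[B.G n]).left.base ⊆ Set.range (j n).left.base) ∧
      (∀ (n m : ℕ) (h : n ≤ m), incl₀ h ≫ (j m).left = (j n).left ≫ (B.transition h).left) ∧
      (∀ (n m : ℕ) (h : n ≤ m), IsClosedImmersion (incl₀ h)) ∧
      (∀ (n m : ℕ) (h : n ≤ m), incl₀ h ≫ (G₀ m).hom = (G₀ n).hom) ∧
      (∀ n, incl₀ (le_refl n) = 𝟙 _) ∧
      (∀ (n m k : ℕ) (h₁ : n ≤ m) (h₂ : m ≤ k), incl₀ h₁ ≫ incl₀ h₂ = incl₀ (h₁.trans h₂)) := by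
  classical
  haveI : HenselianLocalRing A := henselianLocalRing_of_isArtinianRing A
  -- the unit component of each layer
  have hex : ∀ n, ∃ (G₀ : Over (Spec (.of A))) (_ : GrpObj G₀) (j : G₀ ⟶ B.G n),
      (letI := B.grpObj n; IsMonHom j) ∧ IsOpenImmersion j.left ∧ IsClosedImmersion j.left ∧ ConnectedSpace ↥G₀.left := by
    intro n
    letI := B.grpObj n
    haveI : IsFinite (B.G n).hom := B.isFinite n
    haveI : IsAffine (B.G n).left := isAffine_of_isAffineHom (B.G n).hom
    exact exists_unitComponent A (B.G n)
  choose G₀ inst j hjhom hjo hjc hconn using hex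
  -- the unit sections factor through the unit components
  have hunit : ∀ n, letI := B.grpObj n; Set.range (η[B.G n]).left.base ⊆ Set.range (j n).left.base := by
    intro n
    letI := B.grpObj n
    haveI := hjhom n
    rintro _ ⟨s, rfl⟩
    refine ⟨(η[G₀ n]).left.base s, ?_⟩
    rw [← Scheme.Hom.comp_apply, ← Over.comp_left, IsMonHom.one_hom (f := j n)]
  -- the sub-tower maps: `j n ≫ transition` factors uniquely through `j m`
  have hfac : ∀ (n m : ℕ) (h : n ≤ m), ∃! t₀ : G₀ n ⟶ G₀ m, t₀ ≫ j m = j n ≫ B.transition h := by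
    intro n m h
    letI := B.grpObj n; letI := B.grpObj m
    haveI := hjhom n; haveI := hjo m; haveI := hjc m; haveI := hconn n
    haveI : IsMonHom (B.transition h) := B.isMonHom_transition h
    refine existsUnique_fac_of_connectedSpace (j m) (j n ≫ B.transition h)
      ((η[G₀ n]).left.base (IsLocalRing.closedPoint A)) ?_
    apply hunit m
    refine ⟨IsLocalRing.closedPoint A, ?_⟩
    rw [← Scheme.Hom.comp_apply, ← Over.comp_left, ← Category.assoc, IsMonHom.one_hom (f := j n), IsMonHom.one_hom (f := B.transition h)]
  choose t ht htu using hfac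
  have ht' : ∀ (n m : ℕ) (h : n ≤ m), t n m h ≫ j m = j n ≫ B.transition h := fun n m h => ht n m h
  have htu' : ∀ (n m : ℕ) (h : n ≤ m) (y : G₀ n ⟶ G₀ m), y ≫ j m = j n ≫ B.transition h → y = t n m h :=
    fun n m h y hy => htu n m h y hy
  refine ⟨G₀, inst, j, fun n m h => (t n m h).left, hjhom, hjo, hjc, hconn, ?_, ?_, ?_, hunit, ?_, ?_, fun n m h => Over.w (t n m h),
    ?_, ?_⟩
  · intro n
    haveI := hjc n
    haveI : IsFinite (B.G n).hom := B.isFinite n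
    haveI : IsAffine (B.G n).left := isAffine_of_isAffineHom (B.G n).hom
    exact isAffine_of_isAffineHom (j n).left
  · intro n
    haveI := hjc n; haveI := hjo n
    haveI : IsFinite (B.G n).hom := B.isFinite n
    exact (isFinite_and_flat_of_immersions (j n)).1
  · intro n
    haveI := hjc n; haveI := hjo n
    haveI : IsFinite (B.G n).hom := B.isFinite n
    exact (isFinite_and_flat_of_immersions (j n)).2 (B.flat n)
  · intro n m h
    exact congrArg Over.Hom.left (ht' n m h)
  · intro n m h
    haveI := hjc n; haveI := hjc m
    haveI : IsClosedImmersion (B.transition h).left := B.isClosedImmersion_transition_left h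
    haveI : IsClosedImmersion ((t n m h).left ≫ (j m).left) := by
      rw [← Over.comp_left, ht' n m h, Over.comp_left]; infer_instance
    exact IsClosedImmersion.of_comp_isClosedImmersion (t n m h).left (j m).left
  · intro n
    have h1 : t n n (le_refl n) = 𝟙 (G₀ n) :=
      (htu' n n (le_refl n) (𝟙 _) (by rw [Category.id_comp, transition_self, Category.comp_id])).symm
    show (t n n (le_refl n)).left = 𝟙 (G₀ n).left
    rw [h1]; rfl
  · intro n m k h₁ h₂
    have h1 : t n m h₁ ≫ t m k h₂ = t n k (h₁.trans h₂) :=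
      htu' n k (h₁.trans h₂) _ (by rw [Category.assoc, ht' m k h₂, ← Category.assoc, ht' n m h₁, Category.assoc, transition_comp])
    show (t n m h₁).left ≫ (t m k h₂).left = (t n k (h₁.trans h₂)).left
    rw [← Over.comp_left, h1]

end BTGroup

end Literature.AlgebraicGeometry.GroupSchemes

end
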